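import Mathlib
import Summits.CriticalPhenomena.SAWScalingLimit.Theorems.SAWWeldingIdentificationWeldingRigidityTransition

/-!
# Welding rigidity, I bis: rays of the boundary correspondence of a bank uniformiser

Support file for item `stmt-CriticalPhenomena-4505` (`WeldingRigidity`, route
`SAWWeldingIdentification`).

Let `J` be a bank of a simple chord: a Jordan domain whose frontier is `G ∪ A` with `G` (the
chord) and `A` (an arc of `∂Ω`) closed and meeting at most in the endpoints `{a, b}`. For a
uniformiser `φ : ℍₒ → J` normalised by `0 ↦ a`, `∞ ↦ b` and `p ↦ c ∈ A ∖ {a, b}` (`p ≠ 0` real),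
`bank_rays` identifies where the two real rays go under the boundary correspondence
`x ↦ φ.boundaryExtension x` (Carathéodory, PROVED in the tree): the ray on the side of `p` onto
the arc side `A ∖ {a, b}`, the opposite ray into — and onto — the chord side `G ∖ {a, b}`.
Proof: rays are connected and are mapped into `(G ∪ A) ∖ {a, b}`, in which `G` and `A` are
relatively clopen. Folklore (Pommerenke 1992, Thm. 2.6); no definitions.
-/

noncomputable section

open Set Filter Metric Topology Complex
open UpperHalfPlane (upperHalfPlaneSet)

namespace Summit.CriticalPhenomena.SAWScalingLimit.Theorems.WeldingRigidity

open Literature.Probability.RandomPlanarGeometry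
open Literature.Probability.RandomPlanarGeometry.JordanDomain

/-! ### Rays of the boundary correspondence of a bank uniformiser -/

/-- A ray `{x | 0 < p * x}` (`p ≠ 0`) is preconnected: it is the image of `(0, ∞)` under
`t ↦ t / p`. [folklore] -/
theorem isPreconnected_setOf_mul_pos {p : ℝ} (hp0 : p ≠ 0) :
    IsPreconnected {x : ℝ | 0 < p * x} := by
  have h : {x : ℝ | 0 < p * x} = (fun t => t / p) '' Ioi 0 := by
    ext x
    constructor
    · intro hx
      exact ⟨p * x, hx, by field_simp⟩
    · rintro ⟨t, ht, rfl⟩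
      have hpt : p * (t / p) = t := by field_simp
      show 0 < p * (t / p)
      rwa [hpt]
  rw [h]
  exact isPreconnected_Ioi.image _ (continuous_id.div_const p).continuousOn

/-- A ray `{x | p * x < 0}` (`p ≠ 0`) is preconnected: it is the image of `(-∞, 0)` under
`t ↦ t / p`. [folklore] -/
theorem isPreconnected_setOf_mul_neg {p : ℝ} (hp0 : p ≠ 0) :
    IsPreconnected {x : ℝ | p * x < 0} := by
  have h : {x : ℝ | p * x < 0} = (fun t => t / p) '' Iio 0 := by
    ext x
    constructor
    · intro hx
      exact ⟨p * x, hx, by field_simp⟩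
    · rintro ⟨t, ht, rfl⟩
      have hpt : p * (t / p) = t := by field_simp
      show p * (t / p) < 0
      rwa [hpt]
  rw [h]
  exact isPreconnected_Iio.image _ (continuous_id.div_const p).continuousOn

/-- **Rays of the boundary correspondence of a bank.** Let `J` be a Jordan domain whose frontier
is the union of two closed sets `G` (the chord) and `A` (the boundary arc) meeting at most in
`{a, b}`, with `G ∖ {a, b}` nonempty, and let `φ : ℍₒ → J` have boundary values `a` at `0`, `b`
at `∞` and `c ∈ A ∖ {a, b}` at the real point `p ≠ 0`. Then the real ray on the side of `p` is
mapped into `A ∖ {a, b}`, the opposite ray into `G ∖ {a, b}`, and every point of `G ∖ {a, b}`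
is attained on the opposite ray. (Carathéodory's boundary correspondence is a homeomorphism of
`ℝ ∪ {∞}` onto `∂J`; connectedness of rays.) [folklore] -/
theorem bank_rays (J : JordanDomain) {G A : Set ℂ} {a b c : ℂ} {p : ℝ}
    (hfr : frontier J.carrier = G ∪ A) (hGA : G ∩ A ⊆ {a, b}) (hG : IsClosed G)
    (hA : IsClosed A) (hne : (G \ {a, b}).Nonempty) (hcA : c ∈ A) (hca : c ≠ a) (hcb : c ≠ b)
    (hp0 : p ≠ 0) (φ : ConformalEquiv upperHalfPlaneSet J.carrier) (h0 : φ.HasBoundaryValue 0 a)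
    (hinf : φ.HasBoundaryValueAtInfty b) (hpc : φ.HasBoundaryValue (p : ℂ) c) :
    (∀ x : ℝ, 0 < p * x → φ.boundaryExtension x ∈ A \ {a, b}) ∧
    (∀ x : ℝ, p * x < 0 → φ.boundaryExtension x ∈ G \ {a, b}) ∧
    (∀ z ∈ G \ {a, b}, ∃ x : ℝ, p * x < 0 ∧ φ.boundaryExtension x = z) := by
  set e : ℝ → ℂ := fun x => φ.boundaryExtension x with he
  have hcont : Continuous e := continuous_boundaryExtension_ofReal φ
  have he0 : e 0 = a := boundaryExtension_zero_eq φ h0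
  have hep : e p = c := boundaryExtension_ofReal_eq_of_hasBoundaryValue φ hpc
  have hfr' : ∀ x, e x ∈ G ∪ A := fun x => hfr ▸ boundaryExtension_ofReal_mem_frontier' φ x
  have hnea : ∀ x : ℝ, x ≠ 0 → e x ≠ a := fun x hx =>
    boundaryExtension_ofReal_ne_of_ne_zero φ h0 hx
  have hneb : ∀ x : ℝ, e x ≠ b := boundaryExtension_ofReal_ne_of_atInfty φ hinf
  have hnab : ∀ x : ℝ, x ≠ 0 → e x ∉ ({a, b} : Set ℂ) := by
    rintro x hx (h | h)
    · exact hnea x hx h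
    · exact hneb x h
  -- the image of a ray missing `0` lies in `G` or in `A`
  have key : ∀ S : Set ℝ, IsPreconnected S → (0 : ℝ) ∉ S → e '' S ⊆ G ∨ e '' S ⊆ A := by
    intro S hS h0S
    have hpre : IsPreconnected (e '' S) := hS.image e hcont.continuousOn
    rw [isPreconnected_iff_subset_of_disjoint_closed] at hpre
    refine hpre G A hG hA ?_ ?_
    · rintro _ ⟨x, -, rfl⟩
      exact hfr' x
    · rw [Set.eq_empty_iff_forall_notMem]
      rintro _ ⟨⟨x, hx, rfl⟩, hxGA⟩
      exact hnab x (fun hx0 => h0S (hx0 ▸ hx)) (hGA hxGA)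
  -- (1) the ray through `p` goes to the arc `A`
  have hpos : e '' {x | 0 < p * x} ⊆ A := by
    rcases key _ (isPreconnected_setOf_mul_pos hp0) (by simp) with h | h
    · exfalso
      have hcG : c ∈ G := h ⟨p, mul_self_pos.2 hp0, hep⟩
      rcases hGA ⟨hcG, hcA⟩ with h1 | h1
      · exact hca h1
      · exact hcb h1
    · exact h
  have B1 : ∀ x : ℝ, 0 < p * x → e x ∈ A \ {a, b} := fun x hx =>
    ⟨hpos ⟨x, hx, rfl⟩, hnab x (by rintro rfl; simp at hx)⟩
  -- (3) every point of `G ∖ {a, b}` is attained on the opposite ray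
  have B3 : ∀ z ∈ G \ {a, b}, ∃ x : ℝ, p * x < 0 ∧ e x = z := by
    rintro z ⟨hzG, hzab⟩
    have hza : z ≠ a := fun h => hzab (Or.inl h)
    have hzb : z ≠ b := fun h => hzab (Or.inr h)
    have hzfr : z ∈ frontier J.carrier := hfr ▸ Or.inl hzG
    obtain ⟨x, hx⟩ := exists_boundaryExtension_ofReal_eq φ hinf hzfr hzb
    have hx0 : x ≠ 0 := by
      rintro rfl
      exact hza (hx.symm.trans he0)
    rcases lt_trichotomy (p * x) 0 with hlt | heq | hgt
    · exact ⟨x, hlt, hx⟩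
    · exact absurd heq (mul_ne_zero hp0 hx0)
    · exfalso
      have hzA : z ∈ A := hx ▸ (B1 x hgt).1
      exact hzab (hGA ⟨hzG, hzA⟩)
  -- (2) the opposite ray goes to the chord `G`
  have hneg : e '' {x | p * x < 0} ⊆ G := by
    rcases key _ (isPreconnected_setOf_mul_neg hp0) (by simp) with h | h
    · exact h
    · exfalso
      obtain ⟨z₀, hz₀⟩ := hne
      obtain ⟨x₀, hx₀, hx₀z⟩ := B3 z₀ hz₀
      have hz₀A : z₀ ∈ A := hx₀z ▸ h ⟨x₀, hx₀, rfl⟩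
      exact hz₀.2 (hGA ⟨hz₀.1, hz₀A⟩)
  have B2 : ∀ x : ℝ, p * x < 0 → e x ∈ G \ {a, b} := fun x hx =>
    ⟨hneg ⟨x, hx, rfl⟩, hnab x (by rintro rfl; simp at hx)⟩
  exact ⟨B1, B2, B3⟩

end Summit.CriticalPhenomena.SAWScalingLimit.Theorems.WeldingRigidity
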